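import Mathlib
import Summits.CriticalPhenomena.PercolationContinuityZ3.Theorems.PercNearOneGluingNoHeavyLowerTailSahiCombFiveUpSetRank

/-!
# The support lemma with EXPLICIT coefficients (antipodal-basis expansion in closed form)

Support file of the one-cut programme (crux `NoHeavyLowerTail`, stmt-CriticalPhenomena-4575; cell `prim-masterthm`, seat P5 gen 32; memo
`FROM-prim-masterthm-p5-g32-TILTED-DESIGNS.md` §5a).  `…SahiCombFiveUpSetRank.exists_support_coef` says: for an up-set `W` of the cube and any `d`, the zeta row
`t ↦ [d ⊆ t]` restricted to `W` is a combination of the rows `t ↦ [e ⊆ t]` with `eᶜ ∈ W`, `e ⊆ d` (the antipodal basis, C1).  Here the coefficients are written down: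

  `suppCoef W d e = Σ_{g ⊆ d, e ⊆ g, gᶜ ∈ W} (−1)^{#g + #e}`   (a relative Euler characteristic of the down-set `refl W` on the interval `[e, d]`),

and `support_coef_explicit` proves `[d ⊆ t] = Σ_e suppCoef W d e · [e ⊆ t]` for every `t ∈ W` by one exchange of sums and the `±1` trick
(`sum_powerset_neg_one_pow_card_zeta`): the inner sum collapses to `(−1)^{#g}[g ∩ t = ∅]`, and every `g ⊆ d` with `g ∩ t = ∅` has `gᶜ ⊇ t ∈ W`.
Consequence (memo §5a): products `Z[R→W]·Z[refl W→W]⁻¹·Z[refl W→C]` of zeta blocks through the inverse of the C1 block have the closed form `Σ_{g ∈ refl W, g ⊆ q∖c} (−1)^{#g}` —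
the entries of the Schur complements of the tilted rank certificates of `…SahiCombTriWMoveCert`.

* `FiveUpSet.suppCoef` — the coefficients; `suppCoef_ne_zero` — supported on `e ⊆ d` with `eᶜ ∈ W`;
* **`FiveUpSet.support_coef_explicit`** — the expansion on `W`.
HONEST LABEL: elementary identities (std axioms); infrastructure for kernel computations, proves nothing about `TriWIneq` by itself. [this work]
-/

namespace Summit.CriticalPhenomena.PercolationContinuityZ3.Theorems

namespace FiveUpSet

open Finset

variable {α : Type*} [DecidableEq α] [Fintype α]

/-- The explicit support coefficients: `suppCoef W d e = Σ_{g ⊆ d, e ⊆ g, gᶜ ∈ W} (−1)^{#g + #e}`. [this work] -/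
def suppCoef (W : Finset (Finset α)) (d e : Finset α) : ℚ :=
  ∑ g ∈ d.powerset, if e ⊆ g ∧ gᶜ ∈ W then (-1 : ℚ) ^ (g.card + e.card) else 0

/-- `suppCoef W d e ≠ 0` forces `e ⊆ d` and `eᶜ ∈ W` (for an up-set `W`). [this work] -/
theorem suppCoef_ne_zero {W : Finset (Finset α)} (hW : IsUpperSet (W : Set (Finset α))) {d e : Finset α}
    (h : suppCoef W d e ≠ 0) : eᶜ ∈ W ∧ e ⊆ d := by
  obtain ⟨g, hg, hne⟩ := Finset.exists_ne_zero_of_sum_ne_zero h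
  have hcond : e ⊆ g ∧ gᶜ ∈ W := by
    by_contra hc
    exact hne (if_neg hc)
  refine ⟨?_, hcond.1.trans (mem_powerset.1 hg)⟩
  have hsub : gᶜ ⊆ eᶜ := compl_subset_compl.2 hcond.1
  exact hW hsub hcond.2

omit [Fintype α] in
/-- The inner alternating sum: for `g` fixed, `Σ_{e ⊆ g} (−1)^{#g + #e} [e ⊆ t] = (−1)^{#g} [g ∩ t = ∅]`. [this work] -/
theorem sum_powerset_neg_one_pow_add_zeta (g t : Finset α) :
    ∑ e ∈ g.powerset, (-1 : ℚ) ^ (g.card + e.card) * (if e ⊆ t then (1 : ℚ) else 0)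
      = (-1 : ℚ) ^ g.card * (if g ∩ t = ∅ then 1 else 0) := by
  rw [← sum_powerset_neg_one_pow_card_zeta g t, Finset.mul_sum]
  refine sum_congr rfl fun e _ => ?_
  rw [pow_add, mul_assoc]

/-- **Support lemma, explicit form.**  For an up-set `W`, any `d` and every `t ∈ W`:
`Σ_e suppCoef W d e · [e ⊆ t] = [d ⊆ t]`. [this work] -/
theorem support_coef_explicit {W : Finset (Finset α)} (hW : IsUpperSet (W : Set (Finset α))) (d t : Finset α) (ht : t ∈ W) :
    ∑ e, suppCoef W d e * (if e ⊆ t then (1 : ℚ) else 0) = if d ⊆ t then 1 else 0 := by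
  -- expand and exchange the two sums
  have hexp : ∑ e, suppCoef W d e * (if e ⊆ t then (1 : ℚ) else 0)
      = ∑ g ∈ d.powerset, (if gᶜ ∈ W then (1 : ℚ) else 0) *
          ∑ e ∈ g.powerset, (-1 : ℚ) ^ (g.card + e.card) * (if e ⊆ t then (1 : ℚ) else 0) := by
    unfold suppCoef
    simp_rw [Finset.sum_mul]
    rw [Finset.sum_comm]
    refine sum_congr rfl fun g hg => ?_
    rw [Finset.mul_sum]
    -- restrict the sum over all `e` to `e ⊆ g`
    rw [← Finset.sum_subset (subset_univ g.powerset)]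
    · refine sum_congr rfl fun e he => ?_
      have heg : e ⊆ g := mem_powerset.1 he
      by_cases hgW : gᶜ ∈ W
      · rw [if_pos ⟨heg, hgW⟩, if_pos hgW, one_mul]
      · rw [if_neg (fun h => hgW h.2), if_neg hgW, zero_mul, zero_mul]
    · intro e _ he
      have heg : ¬ e ⊆ g := fun h => he (mem_powerset.2 h)
      rw [if_neg (fun h => heg h.1), zero_mul]
  rw [hexp]
  simp_rw [sum_powerset_neg_one_pow_add_zeta]
  -- every `g ⊆ d` with `g ∩ t = ∅` has `gᶜ ∈ W`; the others contribute zero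
  have hred : ∑ g ∈ d.powerset, (if gᶜ ∈ W then (1 : ℚ) else 0) * ((-1 : ℚ) ^ g.card * (if g ∩ t = ∅ then 1 else 0))
      = ∑ g ∈ (d \ t).powerset, (-1 : ℚ) ^ g.card := by
    have hsub : (d \ t).powerset ⊆ d.powerset := powerset_mono.2 sdiff_subset
    rw [← Finset.sum_subset hsub]
    · refine sum_congr rfl fun g hg => ?_
      have hgdt : g ⊆ d \ t := mem_powerset.1 hg
      have hgt : g ∩ t = ∅ := by
        rw [← disjoint_iff_inter_eq_empty]
        exact (sdiff_disjoint.mono_left hgdt)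
      have hgW : gᶜ ∈ W := by
        have htg : t ⊆ gᶜ := by
          intro x hx
          rw [mem_compl]
          intro hxg
          have := hgdt hxg
          rw [mem_sdiff] at this
          exact this.2 hx
        exact hW htg ht
      rw [if_pos hgW, if_pos hgt, one_mul, mul_one]
    · intro g hg hng
      have hgd : g ⊆ d := mem_powerset.1 hg
      have hgt : ¬ g ∩ t = ∅ := by
        intro h0
        apply hng
        rw [mem_powerset]
        intro x hx
        rw [mem_sdiff]
        refine ⟨hgd hx, fun hxt => ?_⟩
        have : x ∈ g ∩ t := mem_inter.2 ⟨hx, hxt⟩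
        rw [h0] at this
        simp at this
      rw [if_neg hgt, mul_zero, mul_zero]
  rw [hred, sum_powerset_neg_one_pow_card_rat]
  by_cases hdt : d ⊆ t
  · rw [if_pos (sdiff_eq_empty_iff_subset.2 hdt), if_pos hdt]
  · rw [if_neg (fun h => hdt (sdiff_eq_empty_iff_subset.1 h)), if_neg hdt]

/-- **The zeta pairing of the explicit coefficients with an ARBITRARY point** (the entries of `Z[·→W]·Z[refl W→W]⁻¹·Z[refl W→·]`, memo §5a):
`Σ_e suppCoef W q e · [e ⊆ c] = Σ_{g ⊆ q \ c, gᶜ ∈ W} (−1)^{#g}` — the alternating count of the down-set `refl W` inside the box `q \ c`. [this work] -/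
theorem sum_suppCoef_zeta {W : Finset (Finset α)} (q c : Finset α) :
    ∑ e, suppCoef W q e * (if e ⊆ c then (1 : ℚ) else 0)
      = ∑ g ∈ (q \ c).powerset, (if gᶜ ∈ W then (-1 : ℚ) ^ g.card else 0) := by
  -- expand and exchange the two sums
  have hexp : ∑ e, suppCoef W q e * (if e ⊆ c then (1 : ℚ) else 0)
      = ∑ g ∈ q.powerset, (if gᶜ ∈ W then (1 : ℚ) else 0) *
          ∑ e ∈ g.powerset, (-1 : ℚ) ^ (g.card + e.card) * (if e ⊆ c then (1 : ℚ) else 0) := by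
    unfold suppCoef
    simp_rw [Finset.sum_mul]
    rw [Finset.sum_comm]
    refine sum_congr rfl fun g hg => ?_
    rw [Finset.mul_sum]
    rw [← Finset.sum_subset (subset_univ g.powerset)]
    · refine sum_congr rfl fun e he => ?_
      have heg : e ⊆ g := mem_powerset.1 he
      by_cases hgW : gᶜ ∈ W
      · rw [if_pos ⟨heg, hgW⟩, if_pos hgW, one_mul]
      · rw [if_neg (fun h => hgW h.2), if_neg hgW, zero_mul, zero_mul]
    · intro e _ he
      have heg : ¬ e ⊆ g := fun h => he (mem_powerset.2 h)
      rw [if_neg (fun h => heg h.1), zero_mul]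
  rw [hexp]
  simp_rw [sum_powerset_neg_one_pow_add_zeta]
  have hsub : (q \ c).powerset ⊆ q.powerset := powerset_mono.2 sdiff_subset
  rw [← Finset.sum_subset hsub]
  · refine sum_congr rfl fun g hg => ?_
    have hgqc : g ⊆ q \ c := mem_powerset.1 hg
    have hgc : g ∩ c = ∅ := by
      rw [← disjoint_iff_inter_eq_empty]
      exact (sdiff_disjoint.mono_left hgqc)
    rw [if_pos hgc, mul_one]
    by_cases hgW : gᶜ ∈ W
    · rw [if_pos hgW, if_pos hgW, one_mul]
    · rw [if_neg hgW, if_neg hgW, zero_mul]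
  · intro g hg hng
    have hgq : g ⊆ q := mem_powerset.1 hg
    have hgc : ¬ g ∩ c = ∅ := by
      intro h0
      apply hng
      rw [mem_powerset]
      intro x hx
      rw [mem_sdiff]
      refine ⟨hgq hx, fun hxc => ?_⟩
      have : x ∈ g ∩ c := mem_inter.2 ⟨hx, hxc⟩
      rw [h0] at this
      simp at this
    rw [if_neg hgc, mul_zero, mul_zero]


/-- **Box criterion** (the mechanism behind `support_coef_explicit`, the a = 0 identity `Z[Q→S]·Z[refl S→S]⁻¹·Z[refl S→Q] = Z[Q→Q]` and the zeta part of the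
Schur complement of design A, memo §5b–c): if every `g ⊆ q \ c` has `gᶜ ∈ W`, the pairing collapses to the indicator `[q ⊆ c]`. [this work] -/
theorem sum_suppCoef_zeta_of_box {W : Finset (Finset α)} (q c : Finset α) (hbox : ∀ g, g ⊆ q \ c → gᶜ ∈ W) :
    ∑ e, suppCoef W q e * (if e ⊆ c then (1 : ℚ) else 0) = if q ⊆ c then 1 else 0 := by
  rw [sum_suppCoef_zeta]
  have hall : ∑ g ∈ (q \ c).powerset, (if gᶜ ∈ W then (-1 : ℚ) ^ g.card else 0) = ∑ g ∈ (q \ c).powerset, (-1 : ℚ) ^ g.card := by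
    refine sum_congr rfl fun g hg => ?_
    rw [if_pos (hbox g (mem_powerset.1 hg))]
  rw [hall, sum_powerset_neg_one_pow_card_rat]
  by_cases hqc : q ⊆ c
  · rw [if_pos (sdiff_eq_empty_iff_subset.2 hqc), if_pos hqc]
  · rw [if_neg (fun h => hqc (sdiff_eq_empty_iff_subset.1 h)), if_neg hqc]

/-- The box hypothesis holds whenever `c` contains a member of the up-set `W` inside `q`'s complement region: concretely, if `t ∈ W` and `t ⊆ qᶜ ∪ c`
then every `g ⊆ q \ c` has `gᶜ ⊇ t`, hence `gᶜ ∈ W`.  (With `t = c ∈ W` this is `support_coef_explicit`; with `t ⊆ qᶜ` it gives the a = 0 identity of the memo.) [this work] -/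
theorem box_of_mem_upper {W : Finset (Finset α)} (hW : IsUpperSet (W : Set (Finset α))) (q c t : Finset α) (ht : t ∈ W)
    (htqc : t ⊆ qᶜ ∪ c) : ∀ g, g ⊆ q \ c → gᶜ ∈ W := by
  intro g hg
  have htg : t ⊆ gᶜ := by
    intro x hx
    rw [mem_compl]
    intro hxg
    have hxqc := mem_sdiff.1 (hg hxg)
    rcases mem_union.1 (htqc hx) with hxq | hxc
    · exact (mem_compl.1 hxq) hxqc.1
    · exact hxqc.2 hxc
  exact hW htg ht

end FiveUpSet

end Summit.CriticalPhenomena.PercolationContinuityZ3.Theorems
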